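import Summits.ResolutionOfSingularities.ResolutionOfSingularities.Theorems.WildConesCampaignW46ForcedAtomsFiniteSing
import Summits.ResolutionOfSingularities.ResolutionOfSingularities.Theorems.WildConesCampaignW46ForcedAtomWitnessAffine
import HarnessLib

/-!
# [OURS · L1 W4.6, rung (i) SURFACES IN 3-SPACE, GEOMETRIC FORM — brick 34] NON-VACUITY of the finite-`Sing` forced-atom
# class: every forced-atom state with closed singular points lies in it (so do the kernel witnesses on `𝔸^{n+1}`), and the
# surface rung holds ON AN INHABITED CLASS

Cell res-hironaka (LADDER-RESOLUTION rung L, D-0089), slot W4.6 «restricted regimes as rungs», seat res-L1-s46-pv-2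
(gen 5). Host: route `WildCones`, crux `ClassicalRegimes` (stmt-ResolutionOfSingularities-16884),
`--supports … --as helper`.

HONEST FRAMING. Everything here is OURS; pure logic over brick 33 (`finLocalExitBound_of_le_forcedAtomsSurface`), o1's
regime `Regime.forcedAtom` (p517839) and this seat's kernel witnesses (bricks 25/26, `AffineFermat.regime_forcedAtom`:
the Fermat atom `((x_n^p + Σ_{i<n} x_i^d)·𝒪, p)` on `𝔸^{n+1}_K`, whose only singular point is the CLOSED origin).
NOTHING here is a statement of H. Hironaka's manuscript [Hironaka2017]; no FACT-LIST premise. AI review is weaker than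
expert review.

## What is proved

* `finClass_of_forcedAtom` — a state of `Regime.forcedAtom n` whose singular points are closed lies in the class
  «forced atoms with finitely many singular points in `n + 1` variables» (the hypothesis shape `hRg` of brick 33): the
  new rung EXTENDS the old one.
* `fermat_mem_finClass` — the Fermat state on `𝔸^{n+1}_K` (`K` perfect, `p < d`, `p ∤ d`) lies in the class, EVERY `n`.
* `finLocalExitBound_forcedAtomsSurface_and_inhabited` — `K` algebraically closed: the class in `3` variables, taken
  itself as the regime, has `FinLocalExitBound` AND contains a standard state with non-empty singular locus — the surface
  rung is not about the empty regime.

References: bricks 25/26/33 of this seat; H. Hironaka, ms. 2017, Th. 16.6 p.84 — ROLE only, under adjudication, not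
cited as fact. [folklore]
-/

noncomputable section

-- single-problem summit: the doubled namespace component `ResolutionOfSingularities` is forced
set_option linter.dupNamespace false

open scoped BigOperators Classical
open MvPowerSeries IsLocalRing

namespace Summit.ResolutionOfSingularities.ResolutionOfSingularities.Theorems

namespace CampaignW46.ForcedAtom

open CategoryTheory AlgebraicGeometry TopologicalSpace
open Literature.AlgebraicGeometry.Resolution
open Literature.AlgebraicGeometry.Hironaka2017.S02Preliminaries
open Literature.AlgebraicGeometry.Hironaka2017.Datum
open Literature.AlgebraicGeometry.Hironaka2017.SpecOrders
open Scheme.IdealSheafData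
open WildCones

variable {p : ℕ} [Fact p.Prime] {K : Type} [Field K] [CharP K p] {n : ℕ}

/-! ## The old regime inside the new class -/

/-- [OURS · L1 W4.6; NOT a statement of the manuscript] **The finite-`Sing` class extends `Regime.forcedAtom n`**: a
state of o1's regime (at most one singular point) whose singular points are closed satisfies the hypothesis shape of
brick 33 (finitely many closed singular points, the same germ clauses). Pure logic. [folklore] -/
theorem finClass_of_forcedAtom {A : AmbientDatum p K} {E : IdealExponent A.Z}
    (h : Regime.forcedAtom (p := p) (K := K) n A E)
    (hcl : E.sing ⊆ Literature.AlgebraicGeometry.Hironaka2017.S02Preliminaries.closedPoints A.Z) :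
    E.b = p ∧ Regime.isolatedSing A E ∧ ∀ ξ ∈ E.sing,
      (maximalIdeal (A.Z.presheaf.stalk ξ)).spanFinrank = n + 1 ∧
      (∃ (E₀ : AdicCompletion (maximalIdeal (A.Z.presheaf.stalk ξ)) (A.Z.presheaf.stalk ξ) ≃+*
          MvPowerSeries (Option (Fin n)) K)
        (f₀ : A.Z.presheaf.stalk ξ) (c₀ : (Fin n → ℕ) → K) (w₀ : MvPowerSeries (Option (Fin n)) K),
        stalkIdeal E.J ξ = Ideal.span {f₀} ∧ IsUnit w₀ ∧
          E₀ (algebraMap _ _ f₀) = w₀ * ((X none : MvPowerSeries (Option (Fin n)) K) ^ p -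
            rename (some : Fin n → Option (Fin n)) (ser p n K c₀))) ∧
      (∀ (E₀ : AdicCompletion (maximalIdeal (A.Z.presheaf.stalk ξ)) (A.Z.presheaf.stalk ξ) ≃+*
          MvPowerSeries (Option (Fin n)) K)
        (f₀ : A.Z.presheaf.stalk ξ) (c₀ : (Fin n → ℕ) → K) (w₀ : MvPowerSeries (Option (Fin n)) K),
        stalkIdeal E.J ξ = Ideal.span {f₀} → IsUnit w₀ →
          E₀ (algebraMap _ _ f₀) = w₀ * ((X none : MvPowerSeries (Option (Fin n)) K) ^ p -
            rename (some : Fin n → Option (Fin n)) (ser p n K c₀)) → Isol p n K c₀) :=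
  ⟨h.1, ⟨h.2.1.finite, hcl⟩, h.2.2⟩

/-! ## The Fermat witnesses lie in the class -/

/-- [OURS · L1 W4.6 — NON-VACUITY in every dimension; NOT a statement of the manuscript] Over a perfect field of
characteristic `p`, the Fermat state `((x_n^p + Σ_{i<n} x_i^d)·𝒪, p)` on `𝔸^{n+1}_K` (`p < d`, `p ∤ d`) lies in the
finite-`Sing` forced-atom class in `n + 1` variables: its only singular point is the closed origin (bricks 25/26).
[folklore] -/
theorem fermat_mem_finClass [PerfectRing K p] {d : ℕ} (hpd : p < d) (hd : ¬ p ∣ d) :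
    let A : AmbientDatum p K :=
      { Z := Zs (MvPolynomial (Fin (n + 1)) K)
        hom := Spec.map (CommRingCat.ofHom (algebraMap K (MvPolynomial (Fin (n + 1)) K)))
        irreducible := inferInstanceAs (IrreducibleSpace (PrimeSpectrum (MvPolynomial (Fin (n + 1)) K)))
        smooth := AffineFermat.smooth_spec K n
        quasiCompact := inferInstance }
    let E : IdealExponent A.Z :=
      ⟨shf (MvPolynomial (Fin (n + 1)) K)
        (Ideal.span {MvPolynomial.X (Fin.last n) ^ p + ∑ j : Fin n, MvPolynomial.X (Fin.castSucc j) ^ d}), p⟩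
    E.b = p ∧ Regime.isolatedSing A E ∧ ∀ ξ ∈ E.sing,
      (maximalIdeal (A.Z.presheaf.stalk ξ)).spanFinrank = n + 1 ∧
      (∃ (E₀ : AdicCompletion (maximalIdeal (A.Z.presheaf.stalk ξ)) (A.Z.presheaf.stalk ξ) ≃+*
          MvPowerSeries (Option (Fin n)) K)
        (f₀ : A.Z.presheaf.stalk ξ) (c₀ : (Fin n → ℕ) → K) (w₀ : MvPowerSeries (Option (Fin n)) K),
        stalkIdeal E.J ξ = Ideal.span {f₀} ∧ IsUnit w₀ ∧
          E₀ (algebraMap _ _ f₀) = w₀ * ((X none : MvPowerSeries (Option (Fin n)) K) ^ p -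
            rename (some : Fin n → Option (Fin n)) (ser p n K c₀))) ∧
      (∀ (E₀ : AdicCompletion (maximalIdeal (A.Z.presheaf.stalk ξ)) (A.Z.presheaf.stalk ξ) ≃+*
          MvPowerSeries (Option (Fin n)) K)
        (f₀ : A.Z.presheaf.stalk ξ) (c₀ : (Fin n → ℕ) → K) (w₀ : MvPowerSeries (Option (Fin n)) K),
        stalkIdeal E.J ξ = Ideal.span {f₀} → IsUnit w₀ →
          E₀ (algebraMap _ _ f₀) = w₀ * ((X none : MvPowerSeries (Option (Fin n)) K) ^ p -
            rename (some : Fin n → Option (Fin n)) (ser p n K c₀)) → Isol p n K c₀) :=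
  finClass_of_forcedAtom (AffineFermat.regime_forcedAtom p K n hpd hd) fun x hx =>
    AffineFermat.mem_closedPoints_of_asIdeal_eq K n ((AffineFermat.mem_sing_iff p K n hpd hd x).mp hx)

/-! ## The surface rung on an inhabited class -/

/-- [OURS · L1 W4.6 rung (i) SURFACES IN 3-SPACE, GEOMETRIC FORM, on an INHABITED class; NOT a statement of the
manuscript] Over an algebraically closed field `K` of characteristic `p`: the class «forced atoms with finitely many
singular points in `3` variables», taken itself as the regime, has `FinLocalExitBound` (brick 33), AND it contains a
standard state with non-empty singular locus (the Fermat surface `z^p + x^{p+1} + y^{p+1}` on `𝔸³`). [folklore] -/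
theorem finLocalExitBound_forcedAtomsSurface_and_inhabited [IsAlgClosed K] :
    FinLocalExitBound (p := p) (K := K) (fun A E => E.b = p ∧ Regime.isolatedSing A E ∧ ∀ ξ ∈ E.sing,
      (maximalIdeal (A.Z.presheaf.stalk ξ)).spanFinrank = 2 + 1 ∧
      (∃ (E₀ : AdicCompletion (maximalIdeal (A.Z.presheaf.stalk ξ)) (A.Z.presheaf.stalk ξ) ≃+*
          MvPowerSeries (Option (Fin 2)) K)
        (f₀ : A.Z.presheaf.stalk ξ) (c₀ : (Fin 2 → ℕ) → K) (w₀ : MvPowerSeries (Option (Fin 2)) K),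
        stalkIdeal E.J ξ = Ideal.span {f₀} ∧ IsUnit w₀ ∧
          E₀ (algebraMap _ _ f₀) = w₀ * ((X none : MvPowerSeries (Option (Fin 2)) K) ^ p -
            rename (some : Fin 2 → Option (Fin 2)) (ser p 2 K c₀))) ∧
      (∀ (E₀ : AdicCompletion (maximalIdeal (A.Z.presheaf.stalk ξ)) (A.Z.presheaf.stalk ξ) ≃+*
          MvPowerSeries (Option (Fin 2)) K)
        (f₀ : A.Z.presheaf.stalk ξ) (c₀ : (Fin 2 → ℕ) → K) (w₀ : MvPowerSeries (Option (Fin 2)) K),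
        stalkIdeal E.J ξ = Ideal.span {f₀} → IsUnit w₀ →
          E₀ (algebraMap _ _ f₀) = w₀ * ((X none : MvPowerSeries (Option (Fin 2)) K) ^ p -
            rename (some : Fin 2 → Option (Fin 2)) (ser p 2 K c₀)) → Isol p 2 K c₀)) ∧
    ∃ (A : AmbientDatum p K) (E : IdealExponent A.Z),
      (E.b = p ∧ Regime.isolatedSing A E ∧ ∀ ξ ∈ E.sing,
        (maximalIdeal (A.Z.presheaf.stalk ξ)).spanFinrank = 2 + 1 ∧
        (∃ (E₀ : AdicCompletion (maximalIdeal (A.Z.presheaf.stalk ξ)) (A.Z.presheaf.stalk ξ) ≃+*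
            MvPowerSeries (Option (Fin 2)) K)
          (f₀ : A.Z.presheaf.stalk ξ) (c₀ : (Fin 2 → ℕ) → K) (w₀ : MvPowerSeries (Option (Fin 2)) K),
          stalkIdeal E.J ξ = Ideal.span {f₀} ∧ IsUnit w₀ ∧
            E₀ (algebraMap _ _ f₀) = w₀ * ((X none : MvPowerSeries (Option (Fin 2)) K) ^ p -
              rename (some : Fin 2 → Option (Fin 2)) (ser p 2 K c₀))) ∧
        (∀ (E₀ : AdicCompletion (maximalIdeal (A.Z.presheaf.stalk ξ)) (A.Z.presheaf.stalk ξ) ≃+*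
            MvPowerSeries (Option (Fin 2)) K)
          (f₀ : A.Z.presheaf.stalk ξ) (c₀ : (Fin 2 → ℕ) → K) (w₀ : MvPowerSeries (Option (Fin 2)) K),
          stalkIdeal E.J ξ = Ideal.span {f₀} → IsUnit w₀ →
            E₀ (algebraMap _ _ f₀) = w₀ * ((X none : MvPowerSeries (Option (Fin 2)) K) ^ p -
              rename (some : Fin 2 → Option (Fin 2)) (ser p 2 K c₀)) → Isol p 2 K c₀)) ∧
      E.IsStandard ∧ E.sing.Nonempty := by
  haveI : PerfectRing K p := PerfectField.toPerfectRing p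
  have hp : p.Prime := Fact.out
  have hd : ¬ p ∣ p + 1 := fun h => hp.one_lt.ne' (Nat.dvd_one.mp ((Nat.dvd_add_right (dvd_refl p)).mp h))
  refine ⟨finLocalExitBound_of_le_forcedAtomsSurface _ (fun A E h => h), ?_⟩
  exact ⟨_, _, fermat_mem_finClass (n := 2) (Nat.lt_succ_self p) hd, AffineFermat.isStandard p K 2 (Nat.lt_succ_self p),
    AffineFermat.sing_nonempty p K 2 (Nat.lt_succ_self p) hd⟩

end CampaignW46.ForcedAtom

end Summit.ResolutionOfSingularities.ResolutionOfSingularities.Theorems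

end
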